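import Literature.MathematicalPhysics.QuantumManyBody.DiluteBoseGasUpperBoundLocalization
import Literature.MathematicalPhysics.QuantumManyBody.BoseGasThermodynamicLimitRuelle
import HarnessLib

/-!
# Basti–Cenatiempo–Schlein 2021, App. A, Lemmas A.2–A.4 for mixtures of blocks:
# from grand-canonical (Fock-space) torus data to the canonical Dirichlet thermodynamic limit

Topic `Literature/MathematicalPhysics/QuantumManyBody`, third proofs companion of
`DiluteBoseGasUpperBound.lean` (provefact
`Literature.MathematicalPhysics.QuantumManyBody.BoseGas.BastiCenatiempoSchlein2021_upperBound`),
after `DiluteBoseGasUpperBoundProofs.lean` (Lemma A.2 / (A.13): replication of one block,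
`limsup_energyDensity_le_of_block`) and `DiluteBoseGasUpperBoundLocalization.lean` (Lemma A.1:
`exists_dirichlet_le_periodic`; the canonical assembly
`BastiCenatiempoSchlein2021_upperBound_of_periodicLHYBlocks`).

[BastiCenatiempoSchlein2021, Prop. 1.3] produces a *grand-canonical* trial state: a normalised
`Ψ ∈ 𝓕(Λ_L)` on the torus `L = ρ̃^{-γ}` with `⟨𝒩⟩ ≥ ρ̃L³`, `⟨𝒩²⟩ ≤ Cρ̃²L⁶` and
`⟨𝓗⟩ ≤ 4π𝔞ρ̃²L³(1 + (128/(15√π))√(ρ̃𝔞³)) + 𝓔L³`. Prop. 1.2 (App. A) turns it into the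
canonical bound `e(ρ) ≤ …`: Lemma A.1 (cut-off into a Dirichlet box, sector by sector), Lemma A.2
(replication of the Dirichlet Fock state), and Lemmas A.3–A.4, which pass from the grand-canonical
energy to `e(ρ)` using "the existence of the thermodynamic limit of the specific energy and its
convexity (see [Ruelle])" through a Legendre transform (A.4: `⟨𝓗⟩/L³ ≥ μ⟨𝒩⟩/L³ + ∑_{m ≤ ML³}
(e_L(m/L³) - μm/L³)‖Ψ^{(m)}‖² - μ⟨𝒩²⟩/(ML⁶)`, (A.copies) `e_L(ρ) ≥ (1+R/L)³e(ρ(1+R/L)^{-3})`,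
`… ≥ μρ - e*(μ)`, `sup_μ [μρ - e*(μ)] = e(ρ)`).

This file proves the same passage for the tree's variational objects **without convexity**: the
role of `L³e(⟨𝒩⟩/L³) ≤ ∑_m ‖Ψ^{(m)}‖² E(m, L)` (Jensen) is played by an explicit *mixture of
blocks* — cells of several particle numbers `n` in proportions `c_n = ‖Ψ^{(n)}‖²` inside one
super-block, built with the separated-cells subadditivity `groundStateEnergy_le_sum_cells` of
`BoseGasThermodynamicLimitRuelle.lean` [Ruelle1969, §3.5.11] and replicated by
`limsup_energyDensity_le_of_block`. The truncation `χ(𝒩 ≤ ML³)` by the second moment and the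
density slack are kept exactly as in the printed proof.

## Contents (all proved; no definitions, no named facts)

* `sum_range_mul_div`, `sum_range_runs`, `card_filter_runs_eq` — counting cells of each type.
* `groundStateEnergy_superBlock_le` — **super-blocks**: `k j` blocks of `nb j` bosons in `Λ_{L₀}`
  (`j < P`), the pattern repeated `q` times in the cube of side `s(L₀+R)` (`(∑ k j) q ≤ s³`):
  `E₀^D(q ∑ k j nb j, s(L₀+R)) ≤ q ∑ k j E₀^D(nb j, L₀)`.
* `limsup_energyDensity_le_of_mixture` — **mixtures** (integer multiplicities): if
  `ρ d³ ∑ k j < ∑ k j nb j`, `d ≥ L₀ + R`, then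
  `limsup_N E₀^D(N, L_N)/L_N³ ≤ (ρ/∑ k j nb j) ∑ k j E₀^D(nb j, L₀)`, `L_N = (N/ρ)^{1/3}`;
  `limsup_energyDensity_le_of_mixture_real` — the same with real weights `w j ≥ 0` (`⌊Qw j⌋`,
  `Q → ∞`).
* `tsum_natCast_mul_le_sum_add` (`∑ n c_n ≤ ∑_{n<P} n c_n + ⟨𝒩²⟩/P`), `tsum_natCast_mul_le_sqrt`
  (`⟨𝒩⟩ ≤ √K V` from `⟨𝒩²⟩ ≤ KV²`, `∑ c_n = 1`), `sum_sector_dirichlet_le`, `truncatedMean_ge`,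
  `truncatedEnergy_le`, `sum_toReal_le_one_of_tsum_eq_one` — sector bookkeeping for Fock-space data
  given as weights `c : ℕ → ℝ≥0∞`.
* `BastiCenatiempoSchlein2021_upperBound_of_grandCanonicalLHYBlocks` — **Prop. 1.2 + "Proof of
  Theorem 1.1"**: the printed Prop. 1.3 at `(γ, ε) = (11/10, 1/10)`, stated through the sector
  weights `c_n = ‖Ψ^{(n)}‖²` of the torus Fock state (`∑ c_n = 1`, `∑ n c_n ≥ ρ̃L³`,
  `∑ n² c_n ≤ K(ρ̃L³)²`, `∑ c_n E₀^per(n, L) ≤ (4π𝔞ρ̃²(1 + c₀√(ρ̃𝔞³)) + Kρ̃^{5/2+1/10})L³`,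
  `L = ρ̃^{-11/10}`), implies `BastiCenatiempoSchlein2021_upperBound`; with the real bookkeeping
  `gc_assembly_bookkeeping` (every error is `O(ρ^{5/2+1/10})`, as in the paper's balance
  `α = 1/(2γ)`). What remains for `BastiCenatiempoSchlein2021_upperBound_holds` is therefore exactly
  the Fock-space trial state of [BastiCenatiempoSchlein2021, Prop. 1.3, §§2–5].

## References

* [BastiCenatiempoSchlein2021] G. Basti, S. Cenatiempo, B. Schlein, *A new second-order upper bound
  for the ground state energy of dilute Bose gases*, Forum Math. Sigma 9 (2021) e74
  (arXiv:2101.06222): Props. 1.2–1.3 and Proof of Thm. 1.1 (pp. 3–5), App. A, Lemmas A.1–A.4 with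
  (A.13), (A.copies) (pp. 25–27 of the arXiv text).
* [Ruelle1969] D. Ruelle, *Statistical Mechanics: Rigorous Results* (1969), §3.5.11 (cells with
  corridors; used through `BoseGasThermodynamicLimitRuelle.groundStateEnergy_le_sum_cells`).
-/

noncomputable section

open MeasureTheory Filter Metric
open scoped ENNReal NNReal Topology

namespace Literature.MathematicalPhysics.QuantumManyBody.BoseGas

/-! ### Counting lemmas for block patterns -/

/-- `∑_{i < K q} g(⌊i/q⌋) = ∑_{j < K} q • g(j)`. [folklore] -/
theorem sum_range_mul_div {A : Type*} [AddCommMonoid A] (g : ℕ → A) (K : ℕ) {q : ℕ} (hq : 0 < q) :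
    ∑ i ∈ Finset.range (K * q), g (i / q) = ∑ j ∈ Finset.range K, q • g j := by
  induction K with
  | zero => simp
  | succ K ih =>
    rw [Nat.succ_mul, Finset.sum_range_add, ih, Finset.sum_range_succ]
    congr 1
    rw [Finset.sum_congr rfl (g := fun _ ↦ g K) fun x hx ↦ ?_, Finset.sum_const, Finset.card_range]
    rw [mul_comm, Nat.mul_add_div hq, Nat.div_eq_of_lt (Finset.mem_range.1 hx), add_zero]

/-- **Sums over runs**: if `typ i = j` on the `j`-th run `[∑_{j'<j} k j', ∑_{j'≤j} k j')` for
every `j < P`, then `∑_{i < ∑_{j<P} k j} g(typ i) = ∑_{j < P} k j • g j`. [folklore] -/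
theorem sum_range_runs {A : Type*} [AddCommMonoid A] (g : ℕ → A) (k typ : ℕ → ℕ) (P : ℕ)
    (htyp : ∀ j < P, ∀ i, ∑ j' ∈ Finset.range j, k j' ≤ i → i < ∑ j' ∈ Finset.range (j + 1), k j' → typ i = j) :
    ∑ i ∈ Finset.range (∑ j ∈ Finset.range P, k j), g (typ i) = ∑ j ∈ Finset.range P, k j • g j := by
  -- more generally for the prefix runs `J ≤ P`
  suffices h : ∀ J, J ≤ P → ∑ i ∈ Finset.range (∑ j ∈ Finset.range J, k j), g (typ i) =
      ∑ j ∈ Finset.range J, k j • g j from h P le_rfl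
  intro J hJ
  induction J with
  | zero => simp
  | succ J ih =>
    rw [Finset.sum_range_succ k J, Finset.sum_range_add, ih (Nat.le_of_succ_le hJ), Finset.sum_range_succ]
    congr 1
    rw [Finset.sum_congr rfl (g := fun _ ↦ g J) fun x hx ↦ ?_, Finset.sum_const, Finset.card_range]
    rw [htyp J (lt_of_lt_of_le (Nat.lt_succ_self J) hJ) _ (Nat.le_add_right _ _)
        (by rw [Finset.sum_range_succ]; exact Nat.add_lt_add_left (Finset.mem_range.1 hx) _)]

/-- **The run decomposition exists**: `typ i = #{j < P : ∑_{j' ≤ j} k j' ≤ i}` is `= j` on the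
`j`-th run. [folklore] -/
theorem card_filter_runs_eq (k : ℕ → ℕ) {P j i : ℕ} (hj : j < P) (h1 : ∑ j' ∈ Finset.range j, k j' ≤ i)
    (h2 : i < ∑ j' ∈ Finset.range (j + 1), k j') :
    ((Finset.range P).filter fun j' ↦ ∑ j'' ∈ Finset.range (j' + 1), k j'' ≤ i).card = j := by
  have hmono : Monotone fun m ↦ ∑ j' ∈ Finset.range m, k j' := fun a b hab ↦
    Finset.sum_le_sum_of_subset (Finset.range_mono hab)
  have : ((Finset.range P).filter fun j' ↦ ∑ j'' ∈ Finset.range (j' + 1), k j'' ≤ i) = Finset.range j := by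
    ext j'
    simp only [Finset.mem_filter, Finset.mem_range]
    constructor
    · rintro ⟨-, hle⟩
      by_contra hcon
      have hjj' : j + 1 ≤ j' + 1 := by omega
      exact absurd (lt_of_lt_of_le h2 ((hmono hjj').trans hle)) (lt_irrefl _)
    · intro hj'
      refine ⟨by omega, ?_⟩
      exact (hmono (by omega : j' + 1 ≤ j)).trans h1
  rw [this, Finset.card_range]

/-! ### Super-blocks: a pattern of blocks repeated `q` times inside one Dirichlet box -/

/-- **Super-block energy.** Blocks of `nb j` particles in boxes `Λ_{L₀}`, `k j` of each type `j < P`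
(a pattern of `K = ∑ k j` cells holding `μ = ∑ k j · nb j` particles), repeated `q` times inside
the cube of side `s(L₀ + R)` (`K q ≤ s³` cells of pitch `L₀ + R`):
`E₀^D(q μ, s(L₀+R)) ≤ q ∑_j k j E₀^D(nb j, L₀)`. [cite: BastiCenatiempoSchlein2021, App. A, Lemma A.2 and (A.copies); Ruelle1969, §3.5.11] -/
theorem groundStateEnergy_superBlock_le {v : ℝ → ℝ≥0∞} {R L₀ : ℝ} (hvm : Measurable v)
    (hv : ∀ r, R < r → v r = 0) (hR : 0 ≤ R) (hL₀ : 0 < L₀) (nb k : ℕ → ℕ) {P s q : ℕ} (hq : 0 < q)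
    (hKq : (∑ j ∈ Finset.range P, k j) * q ≤ s ^ 3) :
    groundStateEnergy v (q * ∑ j ∈ Finset.range P, k j * nb j) (s * (L₀ + R)) ≤
      q * ∑ j ∈ Finset.range P, (k j : ℝ≥0∞) * groundStateEnergy v (nb j) L₀ := by
  classical
  -- the block type of a pattern cell and the cells used
  set typ : ℕ → ℕ := fun i ↦ ((Finset.range P).filter fun j' ↦ ∑ j'' ∈ Finset.range (j' + 1), k j'' ≤ i).card
    with htypdef
  have htyp : ∀ j < P, ∀ i, ∑ j' ∈ Finset.range j, k j' ≤ i → i < ∑ j' ∈ Finset.range (j + 1), k j' →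
      typ i = j := fun j hj i h1 h2 ↦ card_filter_runs_eq k hj h1 h2
  set T : Finset (Fin (s ^ 3)) := Finset.univ.filter fun c ↦ (c : ℕ) < (∑ j ∈ Finset.range P, k j) * q with hT
  set n : Fin (s ^ 3) → ℕ := fun c ↦ nb (typ ((c : ℕ) / q)) with hn
  have hmap : T.map Fin.valEmbedding = Finset.range ((∑ j ∈ Finset.range P, k j) * q) := by
    ext i
    simp only [Finset.mem_map, Finset.mem_filter, Finset.mem_univ, true_and, Fin.valEmbedding_apply,
      Finset.mem_range, hT]
    constructor
    · rintro ⟨c, hc, rfl⟩; exact hc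
    · intro hi; exact ⟨⟨i, lt_of_lt_of_le hi hKq⟩, hi, rfl⟩
  have hsumT : ∀ {A : Type} [AddCommMonoid A] (g : ℕ → A),
      ∑ c ∈ T, g (typ ((c : ℕ) / q)) = ∑ j ∈ Finset.range P, (k j * q) • g j := by
    intro A _ g
    have h1 : ∑ c ∈ T, g (typ ((c : ℕ) / q)) =
        ∑ i ∈ T.map Fin.valEmbedding, g (typ (i / q)) := by
      rw [Finset.sum_map]; rfl
    rw [h1, hmap, sum_range_mul_div (fun i ↦ g (typ i)) _ hq, ← Finset.smul_sum,
      sum_range_runs g k typ P htyp, Finset.smul_sum]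
    refine Finset.sum_congr rfl fun j _ ↦ ?_
    rw [smul_smul, mul_comm]
  have hpart : ∑ c ∈ T, n c = q * ∑ j ∈ Finset.range P, k j * nb j := by
    rw [hn]
    simp only []
    rw [hsumT (fun t ↦ nb t), Finset.mul_sum]
    refine Finset.sum_congr rfl fun j _ ↦ ?_
    rw [smul_eq_mul]; ring
  have hE := groundStateEnergy_le_sum_cells hvm hv hR hL₀ (m := s) (L := s * (L₀ + R)) le_rfl T n
  rw [hpart] at hE
  refine hE.trans (le_of_eq ?_)
  rw [hn]
  simp only []
  rw [hsumT (fun t ↦ groundStateEnergy v (nb t) L₀), Finset.mul_sum]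
  refine Finset.sum_congr rfl fun j _ ↦ ?_
  rw [nsmul_eq_mul]; push_cast; ring


/-- **Mixtures of blocks (Lemma A.4 without convexity).** Let blocks of `nb j` bosons in Dirichlet
boxes `Λ_{L₀}` be given with multiplicities `k j`, `j < P`: a pattern of `K = ∑ k j` cells of pitch
`d ≥ L₀ + R` holding `μ = ∑ k j · nb j` particles. If the pattern is denser than `ρ`,
`ρ d³ K < μ`, then `limsup_N E₀^D(N, L_N)/L_N³ ≤ (ρ/μ) ∑_j k j E₀^D(nb j, L₀)` along the
thermodynamic sequence `L_N = (N/ρ)^{1/3}`: repeat the pattern `⌊s³/K⌋` times in a super-block of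
side `s(L₀ + R)` (`groundStateEnergy_superBlock_le`) and replicate the super-block
(`limsup_energyDensity_le_of_block`), `s → ∞`. This is the use the paper makes of the convexity of
`e(ρ)` in Lemma A.4 (a grand-canonical state is at least as energetic as `L³e(⟨𝒩⟩/L³)`), obtained
here directly at the level of trial states. [cite: BastiCenatiempoSchlein2021, App. A, Lemma A.4 and (A.copies)] -/
theorem limsup_energyDensity_le_of_mixture {v : ℝ → ℝ≥0∞} {R L₀ : ℝ} (hv : ∀ r, R < r → v r = 0)
    (hvm : Measurable v) (hR : 0 ≤ R) (hL₀ : 0 < L₀) (nb k : ℕ → ℕ) {P : ℕ} {ρ d : ℝ} (hρ : 0 < ρ)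
    (hd : L₀ + R ≤ d)
    (hρd : ρ * d ^ 3 * ((∑ j ∈ Finset.range P, k j : ℕ) : ℝ) < ((∑ j ∈ Finset.range P, k j * nb j : ℕ) : ℝ)) :
    limsup (fun N : ℕ ↦ groundStateEnergy v N (sideLength ρ N) / ENNReal.ofReal (sideLength ρ N ^ 3))
        atTop ≤
      ENNReal.ofReal (ρ / ((∑ j ∈ Finset.range P, k j * nb j : ℕ) : ℝ)) *
        ∑ j ∈ Finset.range P, (k j : ℝ≥0∞) * groundStateEnergy v (nb j) L₀ := by
  set μ : ℕ := ∑ j ∈ Finset.range P, k j * nb j with hμdef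
  set K : ℕ := ∑ j ∈ Finset.range P, k j with hKdef
  have hd0 : 0 < d := by linarith
  have hμr : (0 : ℝ) < μ := lt_of_le_of_lt (by positivity) hρd
  have hμ : 0 < μ := Nat.cast_pos.1 hμr
  have hK : 0 < K := by
    by_contra hK0
    have hK0' : K = 0 := Nat.eq_zero_of_not_pos hK0
    have hk0 : ∀ j ∈ Finset.range P, k j = 0 := by
      have := Finset.sum_eq_zero_iff.1 (show ∑ j ∈ Finset.range P, k j = 0 from hK0')
      exact this
    have : μ = 0 := Finset.sum_eq_zero fun j hj ↦ by rw [hk0 j hj, zero_mul]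
    omega
  have hKr : (0 : ℝ) < K := Nat.cast_pos.2 hK
  set p : ℝ := L₀ + R with hpdef
  have hp : 0 < p := by rw [hpdef]; linarith
  have hρp : ρ * p ^ 3 * K < μ := by
    refine lt_of_le_of_lt ?_ hρd
    gcongr
  -- choice of the super-block size `s`
  have hg : Tendsto (fun s : ℕ ↦ ρ * (p + (R + 1) / s) ^ 3 + μ * ((1 : ℝ) / s) ^ 3) atTop
      (𝓝 (ρ * (p + 0) ^ 3 + μ * (0 : ℝ) ^ 3)) := by
    have h1 : Tendsto (fun s : ℕ ↦ (R + 1) / (s : ℝ)) atTop (𝓝 0) := tendsto_const_div_atTop_nhds_zero_nat _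
    have h2 : Tendsto (fun s : ℕ ↦ (1 : ℝ) / (s : ℝ)) atTop (𝓝 0) := tendsto_const_div_atTop_nhds_zero_nat _
    exact ((tendsto_const_nhds.add h1).pow 3 |>.const_mul ρ).add ((h2.pow 3).const_mul _)
  rw [add_zero, zero_pow three_ne_zero, mul_zero, add_zero] at hg
  have hlt : ρ * p ^ 3 < μ / K := by rwa [lt_div_iff₀ hKr]
  obtain ⟨s, hs, hs0⟩ := ((hg.eventually (gt_mem_nhds hlt)).and (eventually_gt_atTop 0)).exists
  have hsr : (0 : ℝ) < s := Nat.cast_pos.2 hs0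
  -- `q = ⌊s³/K⌋` copies of the pattern
  set q : ℕ := s ^ 3 / K with hqdef
  have hKq : K * q ≤ s ^ 3 := by rw [mul_comm]; exact Nat.div_mul_le_self _ _
  have hq_ge : (s : ℝ) ^ 3 / K - 1 ≤ q := by
    -- `⌊s³/K⌋ ≥ s³/K - 1`
    have h1 : s ^ 3 < s ^ 3 / K * K + K := Nat.lt_div_mul_add hK
    have h2 : ((s ^ 3 : ℕ) : ℝ) < (s ^ 3 / K : ℕ) * K + K := by exact_mod_cast h1
    push_cast at h2
    rw [hqdef, sub_le_iff_le_add, div_le_iff₀ hKr]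
    linarith
  have hmain : ρ * (s * p + R + 1) ^ 3 < (q * μ : ℕ) := by
    have h1 : ρ * (p + (R + 1) / s) ^ 3 + μ * ((1 : ℝ) / s) ^ 3 < μ / K := hs
    have h2 : ρ * (s * p + R + 1) ^ 3 + μ < μ / K * (s : ℝ) ^ 3 := by
      have h3 : (ρ * (p + (R + 1) / s) ^ 3 + μ * ((1 : ℝ) / s) ^ 3) * (s : ℝ) ^ 3 < μ / K * (s : ℝ) ^ 3 :=
        mul_lt_mul_of_pos_right h1 (by positivity)
      have h4 : (ρ * (p + (R + 1) / s) ^ 3 + μ * ((1 : ℝ) / s) ^ 3) * (s : ℝ) ^ 3 =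
          ρ * (s * p + R + 1) ^ 3 + μ := by
        field_simp
        ring
      linarith
    push_cast
    calc ρ * (s * p + R + 1) ^ 3 < μ / K * (s : ℝ) ^ 3 - μ := by linarith
      _ = ((s : ℝ) ^ 3 / K - 1) * μ := by ring
      _ ≤ q * μ := by gcongr
  have hq : 0 < q := by
    by_contra hq0
    have : q = 0 := Nat.eq_zero_of_not_pos hq0
    rw [this, zero_mul, Nat.cast_zero] at hmain
    exact absurd hmain (not_lt.2 (by positivity))
  have hN₀ : 0 < q * μ := Nat.mul_pos hq hμ
  -- replicate the super-block
  have hblock := limsup_energyDensity_le_of_block hv hvm hR hN₀ (L₀ := s * p) (by positivity) hρ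
    (d := s * p + R + 1) (by linarith) hmain
  have hsuper := groundStateEnergy_superBlock_le hvm hv hR hL₀ nb k hq hKq
  rw [← hpdef, ← hμdef] at hsuper
  calc limsup (fun N : ℕ ↦ groundStateEnergy v N (sideLength ρ N) / ENNReal.ofReal (sideLength ρ N ^ 3)) atTop
      ≤ ENNReal.ofReal (ρ / (q * μ : ℕ)) * groundStateEnergy v (q * μ) (s * p) := hblock
    _ ≤ ENNReal.ofReal (ρ / (q * μ : ℕ)) *
        (q * ∑ j ∈ Finset.range P, (k j : ℝ≥0∞) * groundStateEnergy v (nb j) L₀) := by gcongr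
    _ = ENNReal.ofReal (ρ / μ) * ∑ j ∈ Finset.range P, (k j : ℝ≥0∞) * groundStateEnergy v (nb j) L₀ := by
        rw [← mul_assoc]
        congr 1
        have hqr : (0 : ℝ) < q := Nat.cast_pos.2 hq
        rw [← ENNReal.ofReal_natCast q, ← ENNReal.ofReal_mul (by positivity)]
        congr 1
        push_cast
        field_simp


/-- **Mixtures of blocks with real weights.** For weights `w j ≥ 0` on block types `j < P`
(`nb j` bosons in `Λ_{L₀}` each) with `ρ d³ ∑ w j < ∑ w j · nb j`, `d ≥ L₀ + R`:
`limsup_N E₀^D(N, L_N)/L_N³ ≤ (ρ/∑ w j nb j) ∑_j w j E₀^D(nb j, L₀)` — from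
`limsup_energyDensity_le_of_mixture` with the multiplicities `⌊Q w j⌋`, `Q → ∞`.
[cite: BastiCenatiempoSchlein2021, App. A, Lemma A.4] -/
theorem limsup_energyDensity_le_of_mixture_real {v : ℝ → ℝ≥0∞} {R L₀ : ℝ} (hv : ∀ r, R < r → v r = 0)
    (hvm : Measurable v) (hR : 0 ≤ R) (hL₀ : 0 < L₀) (nb : ℕ → ℕ) (w : ℕ → ℝ) (hw : ∀ j, 0 ≤ w j)
    {P : ℕ} {ρ d : ℝ} (hρ : 0 < ρ) (hd : L₀ + R ≤ d)
    (hρd : ρ * d ^ 3 * ∑ j ∈ Finset.range P, w j < ∑ j ∈ Finset.range P, w j * nb j) :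
    limsup (fun N : ℕ ↦ groundStateEnergy v N (sideLength ρ N) / ENNReal.ofReal (sideLength ρ N ^ 3))
        atTop ≤
      ENNReal.ofReal (ρ / ∑ j ∈ Finset.range P, w j * nb j) *
        ∑ j ∈ Finset.range P, ENNReal.ofReal (w j) * groundStateEnergy v (nb j) L₀ := by
  set μ : ℝ := ∑ j ∈ Finset.range P, w j * nb j with hμdef
  set W : ℝ := ∑ j ∈ Finset.range P, w j with hWdef
  set S : ℝ≥0∞ := ∑ j ∈ Finset.range P, ENNReal.ofReal (w j) * groundStateEnergy v (nb j) L₀ with hSdef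
  set LS := limsup (fun N : ℕ ↦ groundStateEnergy v N (sideLength ρ N) /
    ENNReal.ofReal (sideLength ρ N ^ 3)) atTop with hLS
  have hd0 : 0 < d := by linarith
  have hW0 : 0 ≤ W := Finset.sum_nonneg fun j _ ↦ hw j
  have hμ : 0 < μ := lt_of_le_of_lt (by positivity) hρd
  rcases eq_or_ne S ⊤ with hS | hS
  · rw [hS, ENNReal.mul_top (ne_of_gt (ENNReal.ofReal_pos.2 (div_pos hρ hμ)))]; exact le_top
  set B : ℝ := ∑ j ∈ Finset.range P, (nb j : ℝ) with hBdef
  have hB0 : 0 ≤ B := by positivity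
  set gap : ℝ := μ - ρ * d ^ 3 * W with hgap
  have hgap0 : 0 < gap := by rw [hgap]; linarith
  -- the bound for every large `Q`
  have hQ : ∀ᶠ Q : ℕ in atTop, LS ≤ ENNReal.ofReal (ρ / (μ - B / Q)) * S := by
    filter_upwards [eventually_gt_atTop ⌈B / gap⌉₊, eventually_gt_atTop 0] with Q hQ hQ0
    have hQr : (0 : ℝ) < Q := Nat.cast_pos.2 hQ0
    have hQgap : B < Q * gap := by
      have := (Nat.ceil_le.1 hQ.le)
      have h1 : B / gap < Q := lt_of_le_of_lt (Nat.le_ceil _) (by exact_mod_cast hQ)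
      rwa [div_lt_iff₀ hgap0] at h1
    set k : ℕ → ℕ := fun j ↦ ⌊w j * Q⌋₊ with hkdef
    have hk_le : ∀ j, (k j : ℝ) ≤ w j * Q := fun j ↦ Nat.floor_le (mul_nonneg (hw j) hQr.le)
    have hk_ge : ∀ j, w j * Q - 1 ≤ (k j : ℝ) := fun j ↦ by
      have := Nat.lt_floor_add_one (w j * Q)
      show w j * Q - 1 ≤ ((⌊w j * Q⌋₊ : ℕ) : ℝ)
      linarith
    have hgapμ : gap ≤ μ := by
      rw [hgap]; nlinarith [mul_nonneg (mul_nonneg hρ.le (pow_nonneg hd0.le 3)) hW0]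
    have hBQμ : B < Q * μ := lt_of_lt_of_le hQgap (by gcongr)
    have hK : ((∑ j ∈ Finset.range P, k j : ℕ) : ℝ) ≤ Q * W := by
      rw [Nat.cast_sum, hWdef, Finset.mul_sum]
      exact Finset.sum_le_sum fun j _ ↦ by rw [mul_comm]; exact hk_le j
    set μQ : ℕ := ∑ j ∈ Finset.range P, k j * nb j with hμQ
    have hμQ_ge : Q * μ - B ≤ (μQ : ℝ) := by
      rw [hμQ, Nat.cast_sum, hμdef, hBdef, Finset.mul_sum, ← Finset.sum_sub_distrib]
      refine Finset.sum_le_sum fun j _ ↦ ?_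
      push_cast
      have := hk_ge j
      have hn : (0 : ℝ) ≤ nb j := Nat.cast_nonneg _
      nlinarith
    have hμQ_le : (μQ : ℝ) ≤ Q * μ := by
      rw [hμQ, Nat.cast_sum, hμdef, Finset.mul_sum]
      refine Finset.sum_le_sum fun j _ ↦ ?_
      push_cast
      have := hk_le j
      have hn : (0 : ℝ) ≤ nb j := Nat.cast_nonneg _
      nlinarith
    have hden : 0 < μ - B / Q := by
      rw [sub_pos, div_lt_iff₀ hQr]; linarith
    have hμQpos : (0 : ℝ) < μQ := by linarith
    have hρdQ : ρ * d ^ 3 * ((∑ j ∈ Finset.range P, k j : ℕ) : ℝ) <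
        ((∑ j ∈ Finset.range P, k j * nb j : ℕ) : ℝ) := by
      rw [← hμQ]
      calc ρ * d ^ 3 * ((∑ j ∈ Finset.range P, k j : ℕ) : ℝ) ≤ ρ * d ^ 3 * (Q * W) := by gcongr
        _ = Q * (ρ * d ^ 3 * W) := by ring
        _ = Q * μ - Q * gap := by rw [hgap]; ring
        _ < Q * μ - B := by linarith
        _ ≤ μQ := hμQ_ge
    have hmix := limsup_energyDensity_le_of_mixture hv hvm hR hL₀ nb k hρ hd hρdQ
    rw [← hμQ] at hmix
    refine hmix.trans ?_
    -- compare the integer mixture with `Q S`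
    have hsum : ∑ j ∈ Finset.range P, (k j : ℝ≥0∞) * groundStateEnergy v (nb j) L₀ ≤
        ENNReal.ofReal Q * S := by
      rw [hSdef, Finset.mul_sum]
      refine Finset.sum_le_sum fun j _ ↦ ?_
      rw [← mul_assoc, ← ENNReal.ofReal_mul hQr.le]
      gcongr
      rw [← ENNReal.ofReal_natCast]
      exact ENNReal.ofReal_le_ofReal (by rw [mul_comm]; exact hk_le j)
    calc ENNReal.ofReal (ρ / μQ) * ∑ j ∈ Finset.range P, (k j : ℝ≥0∞) * groundStateEnergy v (nb j) L₀
        ≤ ENNReal.ofReal (ρ / μQ) * (ENNReal.ofReal Q * S) := by gcongr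
      _ = ENNReal.ofReal (ρ * Q / μQ) * S := by
          rw [← mul_assoc, ← ENNReal.ofReal_mul (by positivity)]
          congr 2
          field_simp
      _ ≤ ENNReal.ofReal (ρ / (μ - B / Q)) * S := by
          refine mul_le_mul' (ENNReal.ofReal_le_ofReal ?_) le_rfl
          rw [div_le_div_iff₀ hμQpos hden]
          calc ρ * Q * (μ - B / Q) = ρ * (Q * μ - B) := by field_simp
            _ ≤ ρ * μQ := by gcongr
  -- the limit `Q → ∞`
  have hlim : Tendsto (fun Q : ℕ ↦ ENNReal.ofReal (ρ / (μ - B / Q)) * S) atTop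
      (𝓝 (ENNReal.ofReal (ρ / μ) * S)) := by
    have h1 : Tendsto (fun Q : ℕ ↦ μ - B / (Q : ℝ)) atTop (𝓝 (μ - 0)) :=
      tendsto_const_nhds.sub (tendsto_const_div_atTop_nhds_zero_nat B)
    rw [sub_zero] at h1
    have h2 : Tendsto (fun Q : ℕ ↦ ρ / (μ - B / (Q : ℝ))) atTop (𝓝 (ρ / μ)) :=
      tendsto_const_nhds.div h1 hμ.ne'
    exact ENNReal.Tendsto.mul_const (ENNReal.tendsto_ofReal h2) (Or.inr hS)
  exact ge_of_tendsto hlim hQ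


/-! ### Sector bookkeeping for grand-canonical (Fock-space) data -/

/-- **Truncation of the particle number by the second moment**: for `P ≥ 1`,
`∑' n, n c_n ≤ ∑_{n<P} n c_n + (∑' n, n² c_n)/P` (`χ(𝒩 > M) ≤ 𝒩/M`).
[cite: BastiCenatiempoSchlein2021, App. A, proof of Lemma A.4] -/
theorem tsum_natCast_mul_le_sum_add (c : ℕ → ℝ≥0∞) {P : ℕ} (hP : 0 < P) :
    ∑' n : ℕ, (n : ℝ≥0∞) * c n ≤ ∑ n ∈ Finset.range P, (n : ℝ≥0∞) * c n + (∑' n : ℕ, (n : ℝ≥0∞) ^ 2 * c n) / P := by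
  have hsplit : ∀ g : ℕ → ℝ≥0∞, ∑' n, g n = ∑ n ∈ Finset.range P, g n + ∑' n, g (n + P) := fun g ↦
    (Summable.sum_add_tsum_nat_add' (f := g) (k := P) ENNReal.summable).symm
  rw [hsplit (fun n : ℕ ↦ (n : ℝ≥0∞) * c n)]
  gcongr
  rw [ENNReal.div_eq_inv_mul, hsplit (fun n : ℕ ↦ (n : ℝ≥0∞) ^ 2 * c n), mul_add]
  refine le_add_left (?_ : _ ≤ _)
  rw [← ENNReal.tsum_mul_left]
  refine ENNReal.tsum_le_tsum fun n ↦ ?_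
  have hP' : (P : ℝ≥0∞) ≠ 0 := Nat.cast_ne_zero.2 hP.ne'
  have hPT : (P : ℝ≥0∞) ≠ ⊤ := ENNReal.natCast_ne_top P
  calc ((n + P : ℕ) : ℝ≥0∞) * c (n + P) = (P : ℝ≥0∞)⁻¹ * ((P : ℝ≥0∞) * (n + P : ℕ)) * c (n + P) := by
        rw [← mul_assoc, ENNReal.inv_mul_cancel hP' hPT, one_mul]
    _ ≤ (P : ℝ≥0∞)⁻¹ * (((n + P : ℕ) : ℝ≥0∞) * (n + P : ℕ)) * c (n + P) := by
        gcongr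
        exact_mod_cast Nat.le_add_left P n
    _ = (P : ℝ≥0∞)⁻¹ * (((n + P : ℕ) : ℝ≥0∞) ^ 2 * c (n + P)) := by ring

/-- **The first moment from the second (AM–GM)**: if `∑' c_n = 1` and `∑' n² c_n ≤ K V²` then
`∑' n c_n ≤ √K V`. [folklore] -/
theorem tsum_natCast_mul_le_sqrt (c : ℕ → ℝ≥0∞) (hc : ∑' n, c n = 1) {K V : ℝ} (hK : 0 < K) (hV : 0 < V)
    (h2 : ∑' n : ℕ, (n : ℝ≥0∞) ^ 2 * c n ≤ ENNReal.ofReal (K * V ^ 2)) :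
    ∑' n : ℕ, (n : ℝ≥0∞) * c n ≤ ENNReal.ofReal (Real.sqrt K * V) := by
  set A : ℝ := Real.sqrt K * V with hA
  have hA0 : 0 < A := by positivity
  -- pointwise `n ≤ n²/(2A) + A/2`
  have hpt : ∀ n : ℕ, (n : ℝ≥0∞) ≤ ENNReal.ofReal (1 / (2 * A)) * (n : ℝ≥0∞) ^ 2 + ENNReal.ofReal (A / 2) := by
    intro n
    have hr : (n : ℝ) ≤ 1 / (2 * A) * (n : ℝ) ^ 2 + A / 2 := by
      have h := sq_nonneg ((n : ℝ) - A)
      rw [div_mul_eq_mul_div, one_mul, div_add_div _ _ (by positivity) (by positivity),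
        le_div_iff₀ (by positivity)]
      nlinarith
    calc (n : ℝ≥0∞) = ENNReal.ofReal (n : ℝ) := (ENNReal.ofReal_natCast n).symm
      _ ≤ ENNReal.ofReal (1 / (2 * A) * (n : ℝ) ^ 2 + A / 2) := ENNReal.ofReal_le_ofReal hr
      _ = ENNReal.ofReal (1 / (2 * A)) * (n : ℝ≥0∞) ^ 2 + ENNReal.ofReal (A / 2) := by
          rw [ENNReal.ofReal_add (by positivity) (by positivity), ENNReal.ofReal_mul (by positivity),
            ENNReal.ofReal_pow (Nat.cast_nonneg _), ENNReal.ofReal_natCast]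
  calc ∑' n : ℕ, (n : ℝ≥0∞) * c n
      ≤ ∑' n : ℕ, (ENNReal.ofReal (1 / (2 * A)) * ((n : ℝ≥0∞) ^ 2 * c n) + ENNReal.ofReal (A / 2) * c n) := by
        refine ENNReal.tsum_le_tsum fun n ↦ ?_
        calc (n : ℝ≥0∞) * c n ≤ (ENNReal.ofReal (1 / (2 * A)) * (n : ℝ≥0∞) ^ 2 + ENNReal.ofReal (A / 2)) * c n :=
              mul_le_mul' (hpt n) le_rfl
          _ = _ := by ring
    _ = ENNReal.ofReal (1 / (2 * A)) * ∑' n : ℕ, (n : ℝ≥0∞) ^ 2 * c n + ENNReal.ofReal (A / 2) * ∑' n, c n := by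
        rw [ENNReal.tsum_add, ENNReal.tsum_mul_left, ENNReal.tsum_mul_left]
    _ ≤ ENNReal.ofReal (1 / (2 * A)) * ENNReal.ofReal (K * V ^ 2) + ENNReal.ofReal (A / 2) * 1 := by
        rw [hc]; gcongr
    _ = ENNReal.ofReal (Real.sqrt K * V) := by
        rw [mul_one, ← ENNReal.ofReal_mul (by positivity), ← ENNReal.ofReal_add (by positivity) (by positivity)]
        congr 1
        have hsq : Real.sqrt K * Real.sqrt K = K := Real.mul_self_sqrt hK.le
        rw [hA]
        field_simp
        nlinarith [hsq]

/-- **Sector-wise localisation, summed**: if `E₀^D(n, L₀) ≤ A E₀^per(n, L) + D·n` for every `n`,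
then `∑_{n<P} c_n E₀^D(n, L₀) ≤ A ∑_{n<P} c_n E₀^per(n, L) + D ∑_{n<P} n c_n`.
[cite: BastiCenatiempoSchlein2021, App. A, Lemma A.1 (A.2)] -/
theorem sum_sector_dirichlet_le {v : ℝ → ℝ≥0∞} {L₀ L : ℝ} {A : ℝ≥0∞} {D : ℝ} (hD : 0 ≤ D)
    (hloc : ∀ n : ℕ, groundStateEnergy v n L₀ ≤ A * periodicGroundStateEnergy v n L + ENNReal.ofReal (D * n))
    (c : ℕ → ℝ≥0∞) (P : ℕ) :
    ∑ n ∈ Finset.range P, c n * groundStateEnergy v n L₀ ≤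
      A * ∑ n ∈ Finset.range P, c n * periodicGroundStateEnergy v n L +
        ENNReal.ofReal D * ∑ n ∈ Finset.range P, (n : ℝ≥0∞) * c n := by
  rw [Finset.mul_sum, Finset.mul_sum, ← Finset.sum_add_distrib]
  refine Finset.sum_le_sum fun n _ ↦ ?_
  calc c n * groundStateEnergy v n L₀ ≤ c n * (A * periodicGroundStateEnergy v n L + ENNReal.ofReal (D * n)) :=
        mul_le_mul' le_rfl (hloc n)
    _ = A * (c n * periodicGroundStateEnergy v n L) + ENNReal.ofReal D * ((n : ℝ≥0∞) * c n) := by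
        rw [ENNReal.ofReal_mul hD, ENNReal.ofReal_natCast]; ring

/-- `(1 + 2x)³ < (1 + 8x)(1 - x/16)` for `0 < x ≤ 1/16`. [folklore] -/
theorem one_add_two_mul_pow_three_lt' {x : ℝ} (hx0 : 0 < x) (hx : x ≤ 1 / 16) :
    (1 + 2 * x) ^ 3 < (1 + 8 * x) * (1 - x / 16) := by
  nlinarith [mul_pos hx0 hx0, mul_pos (mul_pos hx0 hx0) hx0]



/-- Truncated sector weights have total mass `≤ 1`. [folklore] -/
theorem sum_toReal_le_one_of_tsum_eq_one {c : ℕ → ℝ≥0∞} (hc1 : ∑' n, c n = 1) (P : ℕ) :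
    ∑ n ∈ Finset.range P, (c n).toReal ≤ 1 := by
  have hcfin : ∀ n, c n ≠ ⊤ := fun n ↦
    ne_top_of_le_ne_top ENNReal.one_ne_top (hc1 ▸ ENNReal.le_tsum n)
  have h1 : ∑ n ∈ Finset.range P, c n ≤ 1 := hc1 ▸ ENNReal.sum_le_tsum _
  have h2 : (∑ n ∈ Finset.range P, c n).toReal ≤ (1 : ℝ≥0∞).toReal :=
    ENNReal.toReal_mono ENNReal.one_ne_top h1
  rwa [ENNReal.toReal_sum (fun n _ ↦ hcfin n), ENNReal.toReal_one] at h2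

/-- **The truncated mean particle number**: if `⟨𝒩⟩ ≥ V`, `⟨𝒩²⟩ ≤ KV²` and `P ≥ 16KV/x`, then
`∑_{n<P} n c_n ≥ V(1 - x/16)`. [cite: BastiCenatiempoSchlein2021, App. A, proof of Lemma A.4] -/
theorem truncatedMean_ge {c : ℕ → ℝ≥0∞} (hc1 : ∑' n, c n = 1) {V K x : ℝ} (hV0 : 0 < V) (hK : 0 < K)
    (hx0 : 0 < x) {P : ℕ} (hP : 0 < P) (hPge : 16 * K * V / x ≤ P)
    (hcN : ENNReal.ofReal V ≤ ∑' n : ℕ, (n : ℝ≥0∞) * c n)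
    (hcN2 : ∑' n : ℕ, (n : ℝ≥0∞) ^ 2 * c n ≤ ENNReal.ofReal (K * V ^ 2)) :
    V * (1 - x / 16) ≤ ∑ n ∈ Finset.range P, (c n).toReal * n := by
  have hcfin : ∀ n, c n ≠ ⊤ := fun n ↦
    ne_top_of_le_ne_top ENNReal.one_ne_top (hc1 ▸ ENNReal.le_tsum n)
  have hPr : (0 : ℝ) < P := Nat.cast_pos.2 hP
  have hA : ∑ n ∈ Finset.range P, (n : ℝ≥0∞) * c n ≠ ⊤ :=
    ENNReal.sum_ne_top.2 fun n _ ↦ ENNReal.mul_ne_top (ENNReal.natCast_ne_top n) (hcfin n)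
  have hDiv : ENNReal.ofReal (K * V ^ 2) / P ≠ ⊤ :=
    ENNReal.div_ne_top ENNReal.ofReal_ne_top (Nat.cast_ne_zero.2 hP.ne')
  have h2 : ENNReal.ofReal V ≤ ∑ n ∈ Finset.range P, (n : ℝ≥0∞) * c n + ENNReal.ofReal (K * V ^ 2) / P :=
    hcN.trans ((tsum_natCast_mul_le_sum_add c hP).trans (by gcongr))
  have h3 : V ≤ (∑ n ∈ Finset.range P, (n : ℝ≥0∞) * c n).toReal + K * V ^ 2 / P := by
    have h4 := ENNReal.toReal_mono (ENNReal.add_ne_top.2 ⟨hA, hDiv⟩) h2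
    rwa [ENNReal.toReal_ofReal hV0.le, ENNReal.toReal_add hA hDiv, ENNReal.toReal_div,
      ENNReal.toReal_ofReal (by positivity), ENNReal.toReal_natCast] at h4
  have h5 : (∑ n ∈ Finset.range P, (n : ℝ≥0∞) * c n).toReal = ∑ n ∈ Finset.range P, (c n).toReal * n := by
    rw [ENNReal.toReal_sum fun n _ ↦ ENNReal.mul_ne_top (ENNReal.natCast_ne_top n) (hcfin n)]
    refine Finset.sum_congr rfl fun n _ ↦ ?_
    rw [ENNReal.toReal_mul, ENNReal.toReal_natCast, mul_comm]
  have h6 : K * V ^ 2 / P ≤ V * x / 16 := by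
    rw [div_le_iff₀ hPr]
    have : K * V ^ 2 = V * x / 16 * (16 * K * V / x) := by field_simp
    rw [this]
    gcongr
  nlinarith

/-- **The energy of the truncated, localised sectors**: with `E₀^D(n, L₀) ≤ A E₀^per(n, L) + D n`
for all `n`, `∑ c_n E₀^per(n, L) ≤ B'`, `∑ c_n = 1` and `⟨𝒩²⟩ ≤ KV²`:
`∑_{n<P} c_n E₀^D(n, L₀) ≤ A B' + D √K V`. [cite: BastiCenatiempoSchlein2021, App. A, Lemma A.1 and proof of Prop. 1.2] -/
theorem truncatedEnergy_le {v : ℝ → ℝ≥0∞} {L₀ L : ℝ} {A B' : ℝ≥0∞} {D : ℝ} (hD : 0 ≤ D)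
    (hloc : ∀ n : ℕ, groundStateEnergy v n L₀ ≤ A * periodicGroundStateEnergy v n L + ENNReal.ofReal (D * n))
    {c : ℕ → ℝ≥0∞} (hc1 : ∑' n, c n = 1) {K V : ℝ} (hK : 0 < K) (hV : 0 < V)
    (hcN2 : ∑' n : ℕ, (n : ℝ≥0∞) ^ 2 * c n ≤ ENNReal.ofReal (K * V ^ 2))
    (hcE : ∑' n : ℕ, c n * periodicGroundStateEnergy v n L ≤ B') (P : ℕ) :
    ∑ n ∈ Finset.range P, c n * groundStateEnergy v n L₀ ≤ A * B' + ENNReal.ofReal (D * (Real.sqrt K * V)) := by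
  have h2 : ∑ n ∈ Finset.range P, c n * periodicGroundStateEnergy v n L ≤ B' :=
    (ENNReal.sum_le_tsum _).trans hcE
  have h3 : ∑ n ∈ Finset.range P, (n : ℝ≥0∞) * c n ≤ ENNReal.ofReal (Real.sqrt K * V) :=
    (ENNReal.sum_le_tsum _).trans (tsum_natCast_mul_le_sqrt c hc1 hK hV hcN2)
  calc ∑ n ∈ Finset.range P, c n * groundStateEnergy v n L₀
      ≤ A * ∑ n ∈ Finset.range P, c n * periodicGroundStateEnergy v n L +
          ENNReal.ofReal D * ∑ n ∈ Finset.range P, (n : ℝ≥0∞) * c n := sum_sector_dirichlet_le hD hloc c P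
    _ ≤ A * B' + ENNReal.ofReal D * ENNReal.ofReal (Real.sqrt K * V) := by gcongr
    _ = A * B' + ENNReal.ofReal (D * (Real.sqrt K * V)) := by rw [ENNReal.ofReal_mul hD]

/-- `2^{11/5} ≤ 5`. [folklore] -/
theorem two_rpow_eleven_fifths_le : (2 : ℝ) ^ ((11 : ℝ) / 5) ≤ 5 := by
  calc (2 : ℝ) ^ ((11 : ℝ) / 5) = ((2 : ℝ) ^ (11 : ℕ)) ^ ((5 : ℕ) : ℝ)⁻¹ := by
        rw [← Real.rpow_natCast, ← Real.rpow_mul (by norm_num)]; norm_num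
    _ ≤ ((5 : ℝ) ^ (5 : ℕ)) ^ ((5 : ℕ) : ℝ)⁻¹ :=
        Real.rpow_le_rpow (by norm_num) (by norm_num) (by norm_num)
    _ = 5 := Real.pow_rpow_inv_natCast (by norm_num) (by norm_num)

/-- `ρ · ρ^{-3/5} · ρ^{11/5} = ρ^{5/2+1/10}`. [folklore] -/
theorem mul_rpow_inv_three_fifths_mul {ρ : ℝ} (hρ : 0 < ρ) :
    ρ * (ρ ^ ((3 : ℝ) / 5))⁻¹ * ρ ^ ((11 : ℝ) / 5) = ρ ^ ((5 : ℝ) / 2 + 1 / 10) := by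
  rw [← Real.rpow_neg hρ.le]
  conv_lhs => rw [show ρ * ρ ^ (-((3 : ℝ) / 5)) * ρ ^ ((11 : ℝ) / 5) =
    ρ ^ (1 : ℝ) * ρ ^ (-((3 : ℝ) / 5)) * ρ ^ ((11 : ℝ) / 5) by rw [Real.rpow_one]]
  rw [← Real.rpow_add hρ, ← Real.rpow_add hρ]
  norm_num

/-- **Real bookkeeping of the grand-canonical assembly** (all errors `O(ρ^{5/2+1/10})`).
[cite: BastiCenatiempoSchlein2021, Proof of Thm. 1.1 (1.6)–(1.8)] -/
theorem gc_assembly_bookkeeping {ρ x K Cl T₀ C₁ Mr Lp μ V ρt B MT : ℝ} (hρ : 0 < ρ) (hx0 : 0 < x)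
    (hx : x ≤ 1 / 16) (hCl : 0 ≤ Cl) (hMr : 0 < Mr) (hMle : Mr ≤ 2 * x⁻¹) (hMinv : Mr⁻¹ ≤ x)
    (hLp0 : 0 < Lp) (hLpinv2 : (Lp ^ 2)⁻¹ ≤ 2 ^ ((11 : ℝ) / 5) * ρ ^ ((11 : ℝ) / 5)) (hV0 : 0 < V)
    (hVdef : V = ρt * Lp ^ 3) (hρt0 : 0 < ρt) (hμ_ge : V * (1 - x / 16) ≤ μ) (hB0 : 0 ≤ B)
    (hmain : ρ / ρt * B ≤ MT + C₁ * ρ ^ ((5 : ℝ) / 2 + 1 / 10)) (hMT0 : 0 ≤ MT) (hMTle : MT ≤ T₀ * ρ ^ 2)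
    (hC₁0 : 0 ≤ C₁) (hρ26 : ρ ^ ((5 : ℝ) / 2 + 1 / 10) = ρ ^ 2 * x)
    (hcomb : ρ * x⁻¹ * ρ ^ ((11 : ℝ) / 5) = ρ ^ ((5 : ℝ) / 2 + 1 / 10)) :
    ρ / μ * ((1 + 4 / Mr) * (B * Lp ^ 3)) + ρ / μ * (Cl / (Mr * (Lp / (2 * Mr)) ^ 2) * (Real.sqrt K * V)) ≤
      MT + (C₁ + 5 * (T₀ + C₁) + 80 * Cl * Real.sqrt K) * ρ ^ ((5 : ℝ) / 2 + 1 / 10) := by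
  have hx1 : x ≤ 1 := by linarith
  have hμ0 : 0 < μ := lt_of_lt_of_le (by nlinarith) hμ_ge
  have hρ26' : 0 < ρ ^ ((5 : ℝ) / 2 + 1 / 10) := Real.rpow_pos_of_pos hρ _
  have hρ26le : ρ ^ ((5 : ℝ) / 2 + 1 / 10) ≤ ρ ^ 2 := by
    rw [hρ26]; exact mul_le_of_le_one_right (sq_nonneg _) hx1
  have hK0 : 0 ≤ Real.sqrt K := Real.sqrt_nonneg _
  -- `1/μ ≤ (1 + x/8)/V ≤ 2/V`
  have hθ : (1 - x / 16)⁻¹ ≤ 1 + x / 8 := by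
    rw [inv_eq_one_div, div_le_iff₀ (by linarith)]
    nlinarith
  have hθ0 : 0 ≤ (1 - x / 16)⁻¹ := inv_nonneg.2 (by linarith)
  have hρμ : ρ / μ ≤ ρ / V * (1 - x / 16)⁻¹ := by
    have hne : (1 - x / 16) ≠ 0 := by linarith
    have h1 : ρ / V * (1 - x / 16)⁻¹ = ρ / (V * (1 - x / 16)) := by
      field_simp
    rw [h1]
    exact div_le_div_of_nonneg_left hρ.le (by nlinarith) hμ_ge
  -- (a) the block term
  have hterm1 : ρ / μ * ((1 + 4 / Mr) * (B * Lp ^ 3)) ≤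
      MT + (C₁ + 5 * (T₀ + C₁)) * ρ ^ ((5 : ℝ) / 2 + 1 / 10) := by
    have h1 : ρ / V * (B * Lp ^ 3) = ρ / ρt * B := by
      rw [hVdef]; field_simp
    have h3 : 4 / Mr ≤ 4 * x := by rw [div_eq_mul_inv]; gcongr
    have h5 : (1 + 4 * x) * (1 + x / 8) ≤ 1 + 5 * x := by nlinarith
    calc ρ / μ * ((1 + 4 / Mr) * (B * Lp ^ 3))
        ≤ ρ / V * (1 - x / 16)⁻¹ * ((1 + 4 / Mr) * (B * Lp ^ 3)) := by gcongr
      _ = (1 + 4 / Mr) * (1 - x / 16)⁻¹ * (ρ / V * (B * Lp ^ 3)) := by ring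
      _ = (1 + 4 / Mr) * (1 - x / 16)⁻¹ * (ρ / ρt * B) := by rw [h1]
      _ ≤ (1 + 4 * x) * (1 + x / 8) * (MT + C₁ * ρ ^ ((5 : ℝ) / 2 + 1 / 10)) := by gcongr
      _ ≤ (1 + 5 * x) * (MT + C₁ * ρ ^ ((5 : ℝ) / 2 + 1 / 10)) := by gcongr
      _ = MT + C₁ * ρ ^ ((5 : ℝ) / 2 + 1 / 10) + 5 * x * (MT + C₁ * ρ ^ ((5 : ℝ) / 2 + 1 / 10)) := by ring
      _ ≤ MT + C₁ * ρ ^ ((5 : ℝ) / 2 + 1 / 10) + 5 * x * (T₀ * ρ ^ 2 + C₁ * ρ ^ 2) := by gcongr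
      _ = MT + (C₁ + 5 * (T₀ + C₁)) * ρ ^ ((5 : ℝ) / 2 + 1 / 10) := by rw [hρ26]; ring
  -- (b) the cut-off term
  have hterm2 : ρ / μ * (Cl / (Mr * (Lp / (2 * Mr)) ^ 2) * (Real.sqrt K * V)) ≤
      80 * Cl * Real.sqrt K * ρ ^ ((5 : ℝ) / 2 + 1 / 10) := by
    have h1 : ρ / V * (Cl / (Mr * (Lp / (2 * Mr)) ^ 2) * (Real.sqrt K * V)) =
        Real.sqrt K * (4 * ρ * Cl * Mr * (Lp ^ 2)⁻¹) := by
      field_simp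
      ring
    have h40 : 4 * ρ * Cl * Mr * (Lp ^ 2)⁻¹ ≤ 40 * Cl * ρ ^ ((5 : ℝ) / 2 + 1 / 10) := by
      calc 4 * ρ * Cl * Mr * (Lp ^ 2)⁻¹ ≤ 4 * ρ * Cl * (2 * x⁻¹) * (2 ^ ((11 : ℝ) / 5) * ρ ^ ((11 : ℝ) / 5)) := by
            gcongr
        _ ≤ 4 * ρ * Cl * (2 * x⁻¹) * (5 * ρ ^ ((11 : ℝ) / 5)) := by gcongr; exact two_rpow_eleven_fifths_le
        _ = 40 * Cl * (ρ * x⁻¹ * ρ ^ ((11 : ℝ) / 5)) := by ring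
        _ = 40 * Cl * ρ ^ ((5 : ℝ) / 2 + 1 / 10) := by rw [hcomb]
    calc ρ / μ * (Cl / (Mr * (Lp / (2 * Mr)) ^ 2) * (Real.sqrt K * V))
        ≤ ρ / V * (1 - x / 16)⁻¹ * (Cl / (Mr * (Lp / (2 * Mr)) ^ 2) * (Real.sqrt K * V)) := by gcongr
      _ = (1 - x / 16)⁻¹ * (ρ / V * (Cl / (Mr * (Lp / (2 * Mr)) ^ 2) * (Real.sqrt K * V))) := by ring
      _ = (1 - x / 16)⁻¹ * (Real.sqrt K * (4 * ρ * Cl * Mr * (Lp ^ 2)⁻¹)) := by rw [h1]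
      _ ≤ 2 * (Real.sqrt K * (40 * Cl * ρ ^ ((5 : ℝ) / 2 + 1 / 10))) := by
          gcongr
          exact hθ.trans (by linarith)
      _ = 80 * Cl * Real.sqrt K * ρ ^ ((5 : ℝ) / 2 + 1 / 10) := by ring
  calc _ ≤ (MT + (C₁ + 5 * (T₀ + C₁)) * ρ ^ ((5 : ℝ) / 2 + 1 / 10)) +
        80 * Cl * Real.sqrt K * ρ ^ ((5 : ℝ) / 2 + 1 / 10) := add_le_add hterm1 hterm2
    _ = MT + (C₁ + 5 * (T₀ + C₁) + 80 * Cl * Real.sqrt K) * ρ ^ ((5 : ℝ) / 2 + 1 / 10) := by ring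


set_option maxHeartbeats 1600000 in
/-- **Theorem 1.1 from the grand-canonical periodic trial states of Prop. 1.3 (Prop. 1.2 +
"Proof of Theorem 1.1" of [BastiCenatiempoSchlein2021], for the tree's objects).** The hypothesis
is [BastiCenatiempoSchlein2021, Prop. 1.3] with `γ = 11/10`, `ε = 1/10` (so that
`𝓔 ≤ Cρ̃^{5/2}·max{ρ̃^ε, ρ̃^{4-3γ-6ε}, ρ̃^{9/4-3γ/2-3ε}} = Cρ̃^{5/2+1/10}`), recorded through the
sector decomposition of the normalised torus Fock state `Ψ = ⊕_n Ψ^{(n)}`: weights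
`c_n = ‖Ψ^{(n)}‖²` with `∑ c_n = 1`, `⟨𝒩⟩ = ∑ n c_n ≥ ρ̃L³`, `⟨𝒩²⟩ = ∑ n²c_n ≤ K(ρ̃L³)²`, and
`∑ c_n E₀^per(n, L) ≤ ⟨Ψ, 𝓗Ψ⟩ ≤ (4π𝔞ρ̃²(1 + (128/(15√π))√(ρ̃𝔞³)) + Kρ̃^{5/2+1/10})L³`,
`L = ρ̃^{-11/10}` (the sectors of `𝓗` are the `n`-body torus Hamiltonians, whose quadratic forms
on `C¹` states are bounded below by `periodicGroundStateEnergy`). Conclusion: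
`BastiCenatiempoSchlein2021_upperBound`. Proof: density shift `ρ̃ = ρ(1 + 8ρ^{3/5})`, sector-wise
localisation into `Λ_{L+2ℓ}` with `M = ⌈ρ^{-3/5}⌉` (Lemma A.1: `exists_dirichlet_le_periodic`,
`truncatedEnergy_le`), truncation of the sectors at `n < 16K ρ̃L³ ρ^{-3/5} + 1` by the second
moment (`truncatedMean_ge`), `⟨𝒩⟩ ≤ √K ρ̃L³` (`tsum_natCast_mul_le_sqrt`), and the mixture
replication `limsup_energyDensity_le_of_mixture_real`, which replaces the convexity /
Legendre-transform argument of Lemmas A.3–A.4; the errors are `O(ρ^{5/2+1/10})`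
(`gc_assembly_bookkeeping`).
[cite: BastiCenatiempoSchlein2021, Thm. 1.1, Props. 1.2–1.3, Proof of Thm. 1.1 (1.6)–(1.8), App. A] -/
theorem BastiCenatiempoSchlein2021_upperBound_of_grandCanonicalLHYBlocks
    (hblocks : ∀ (v : ℝ → ℝ≥0∞) (R : ℝ), Measurable v → (∀ r, R < r → v r = 0) →
      (∫⁻ x : Space, v ‖x‖ ^ 3) ≠ ⊤ → scatteringLength v ≤ ENNReal.ofReal R →
      ∃ K ρ₁ : ℝ, 0 < K ∧ 0 < ρ₁ ∧ ∀ ρt : ℝ, 0 < ρt → ρt < ρ₁ →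
        ∃ c : ℕ → ℝ≥0∞, ∑' n, c n = 1 ∧
          ENNReal.ofReal (ρt * (ρt ^ (-(11 : ℝ) / 10)) ^ 3) ≤ ∑' n : ℕ, (n : ℝ≥0∞) * c n ∧
          ∑' n : ℕ, (n : ℝ≥0∞) ^ 2 * c n ≤
            ENNReal.ofReal (K * (ρt * (ρt ^ (-(11 : ℝ) / 10)) ^ 3) ^ 2) ∧
          ∑' n : ℕ, c n * periodicGroundStateEnergy v n (ρt ^ (-(11 : ℝ) / 10)) ≤
            ENNReal.ofReal ((4 * Real.pi * (scatteringLength v).toReal * ρt ^ 2 *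
                (1 + lhyConstant * Real.sqrt (ρt * (scatteringLength v).toReal ^ 3)) +
              K * ρt ^ ((5 : ℝ) / 2 + 1 / 10)) * (ρt ^ (-(11 : ℝ) / 10)) ^ 3)) :
    BastiCenatiempoSchlein2021_upperBound := by
  intro v R hmeas hsupp hL3 hRa
  set R' : ℝ := max R 0 with hR'def
  have hR'0 : 0 ≤ R' := le_max_right _ _
  have hv' : ∀ r, R' < r → v r = 0 := fun r hr ↦ hsupp r (lt_of_le_of_lt (le_max_left _ _) hr)
  obtain ⟨K, ρ₁, hK, hρ₁, hH⟩ := hblocks v R hmeas hsupp hL3 hRa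
  obtain ⟨Cl, hCl, hloc⟩ := exists_dirichlet_le_periodic
  set a : ℝ := (scatteringLength v).toReal with ha
  have ha0 : 0 ≤ a := ENNReal.toReal_nonneg
  have hc₀ := lhyConstant_pos
  -- constants
  set T₀ : ℝ := 4 * Real.pi * a * (1 + lhyConstant * Real.sqrt (a ^ 3)) with hT₀
  set C₁ : ℝ := 32 * Real.pi * a * (1 + 2 * lhyConstant * Real.sqrt (a ^ 3)) + 4 * K with hC₁
  have hC₁0 : 0 < C₁ := by positivity
  set C : ℝ := C₁ + 5 * (T₀ + C₁) + 80 * Cl * Real.sqrt K with hC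
  -- thresholds
  set ρ₀ : ℝ := min (min (1 / 2) ((1 / 16 : ℝ) ^ ((5 : ℝ) / 3)))
    (min (ρ₁ / 2) ((2 * (R' + 1)) ^ (-(5 : ℝ) / 2))) with hρ₀
  have hρ₀pos : 0 < ρ₀ := by positivity
  refine ⟨C, ρ₀, by positivity, hρ₀pos, fun ρ hρ hρρ₀ ↦ ?_⟩
  simp only []
  have hρhalf : ρ ≤ 1 / 2 := hρρ₀.le.trans ((min_le_left _ _).trans (min_le_left _ _))
  have hρ1 : ρ ≤ 1 := by linarith
  have hρ16 : ρ ≤ (1 / 16 : ℝ) ^ ((5 : ℝ) / 3) := hρρ₀.le.trans ((min_le_left _ _).trans (min_le_right _ _))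
  have hρρ₁ : ρ < ρ₁ / 2 := lt_of_lt_of_le hρρ₀ ((min_le_right _ _).trans (min_le_left _ _))
  have hρR : ρ ≤ (2 * (R' + 1)) ^ (-(5 : ℝ) / 2) := hρρ₀.le.trans ((min_le_right _ _).trans (min_le_right _ _))
  -- `x = ρ^{3/5} ≤ 1/16`
  set x : ℝ := ρ ^ ((3 : ℝ) / 5) with hxdef
  have hx0 : 0 < x := Real.rpow_pos_of_pos hρ _
  have hx : x ≤ 1 / 16 := by
    calc x ≤ ((1 / 16 : ℝ) ^ ((5 : ℝ) / 3)) ^ ((3 : ℝ) / 5) := Real.rpow_le_rpow hρ.le hρ16 (by norm_num)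
      _ = 1 / 16 := by rw [← Real.rpow_mul (by norm_num)]; norm_num
  have hx8 : x ≤ 1 / 8 := by linarith
  have hx1 : x ≤ 1 := by linarith
  -- `2(R'+1) ρ^{2/5} ≤ 1`
  have hRρ : 2 * (R' + 1) * ρ ^ ((2 : ℝ) / 5) ≤ 1 := by
    have h1 : ρ ^ ((2 : ℝ) / 5) ≤ ((2 * (R' + 1)) ^ (-(5 : ℝ) / 2)) ^ ((2 : ℝ) / 5) :=
      Real.rpow_le_rpow hρ.le hρR (by norm_num)
    rw [← Real.rpow_mul (by positivity), show (-(5 : ℝ) / 2 * (2 / 5)) = -1 by norm_num,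
      Real.rpow_neg_one] at h1
    calc 2 * (R' + 1) * ρ ^ ((2 : ℝ) / 5) ≤ 2 * (R' + 1) * (2 * (R' + 1))⁻¹ := by gcongr
      _ = 1 := mul_inv_cancel₀ (by positivity)
  -- the adjusted density and the grand-canonical data
  set ρt : ℝ := ρ * (1 + 8 * x) with hρtdef
  have hρt0 : 0 < ρt := by positivity
  have hρt2 : ρt ≤ 2 * ρ := by rw [hρtdef]; nlinarith
  have hρt1 : ρt ≤ 1 := by linarith
  have hρtρ₁ : ρt < ρ₁ := by linarith
  obtain ⟨c, hc1, hcN, hcN2, hcE⟩ := hH ρt hρt0 hρtρ₁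
  set Lp : ℝ := ρt ^ (-(11 : ℝ) / 10) with hLpdef
  have hLp0 : 0 < Lp := Real.rpow_pos_of_pos hρt0 _
  set V : ℝ := ρt * Lp ^ 3 with hVdef
  have hV0 : 0 < V := by positivity
  set B : ℝ := 4 * Real.pi * a * ρt ^ 2 * (1 + lhyConstant * Real.sqrt (ρt * a ^ 3)) +
    K * ρt ^ ((5 : ℝ) / 2 + 1 / 10) with hBdef
  have hB0 : 0 ≤ B := by positivity
  have hcfin : ∀ n, c n ≠ ⊤ := fun n ↦
    ne_top_of_le_ne_top ENNReal.one_ne_top (hc1 ▸ ENNReal.le_tsum n)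
  have hLpinv : Lp⁻¹ ≤ 2 * ρ := by
    have h1 : ρt⁻¹ ≤ Lp := by
      rw [hLpdef, ← Real.rpow_neg_one]
      exact Real.rpow_le_rpow_of_exponent_ge hρt0 hρt1 (by norm_num)
    calc Lp⁻¹ ≤ (ρt⁻¹)⁻¹ := by gcongr
      _ = ρt := inv_inv _
      _ ≤ 2 * ρ := hρt2
  have hLpinv2 : (Lp ^ 2)⁻¹ ≤ 2 ^ ((11 : ℝ) / 5) * ρ ^ ((11 : ℝ) / 5) := by
    have h1 : (2 * ρ) ^ (-(11 : ℝ) / 10) ≤ Lp := by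
      rw [hLpdef]
      exact Real.rpow_le_rpow_of_nonpos hρt0 hρt2 (by norm_num)
    have h2 : (Lp ^ 2)⁻¹ ≤ (((2 * ρ) ^ (-(11 : ℝ) / 10)) ^ 2)⁻¹ := by
      gcongr
    refine h2.trans (le_of_eq ?_)
    rw [← Real.rpow_natCast, ← Real.rpow_mul (by positivity), ← Real.rpow_neg (by positivity),
      Real.mul_rpow (by norm_num) hρ.le]
    norm_num
  -- the cut-off parameters and Lemma A.1, sector by sector
  set M : ℕ := ⌈ρ ^ (-(3 : ℝ) / 5)⌉₊ with hMdef
  have hxinv : ρ ^ (-(3 : ℝ) / 5) = x⁻¹ := by rw [hxdef, ← Real.rpow_neg hρ.le]; norm_num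
  have hMge : x⁻¹ ≤ M := by rw [hMdef, ← hxinv]; exact Nat.le_ceil _
  have hx_inv1 : 1 ≤ x⁻¹ := one_le_inv_iff₀.2 ⟨hx0, hx1⟩
  have hM1 : (1 : ℝ) ≤ M := hx_inv1.trans hMge
  have hM : 0 < M := by exact_mod_cast (show (0 : ℝ) < M by linarith)
  have hMr : (0 : ℝ) < M := by exact_mod_cast hM
  have hMle : (M : ℝ) ≤ 2 * x⁻¹ := by
    have := Nat.ceil_lt_add_one (Real.rpow_nonneg hρ.le (-(3 : ℝ) / 5))
    rw [← hMdef, hxinv] at this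
    linarith
  have hMinv : (M : ℝ)⁻¹ ≤ x := by
    rw [inv_le_comm₀ hMr hx0]; exact hMge
  set ℓ : ℝ := Lp / (2 * M) with hℓdef
  have hℓ0 : 0 < ℓ := by positivity
  have h2ℓM : 2 * ℓ * M = Lp := by rw [hℓdef]; field_simp
  have hD0 : 0 ≤ Cl / (M * ℓ ^ 2) := by positivity
  have hlocN : ∀ n : ℕ, groundStateEnergy v n (Lp + 2 * ℓ) ≤
      (1 + 4 / (M : ℝ≥0∞)) * periodicGroundStateEnergy v n Lp + ENNReal.ofReal (Cl / (M * ℓ ^ 2) * n) := by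
    intro n
    have h := hloc n ℓ M v hℓ0 hM hmeas
    have e : Cl * n / (M * ℓ ^ 2) = Cl / (M * ℓ ^ 2) * n := by ring
    rw [h2ℓM, e] at h
    exact h
  -- truncation of the sectors
  set P : ℕ := ⌈16 * K * V / x⌉₊ + 1 with hPdef
  have hP : 0 < P := Nat.succ_pos _
  have hPge : 16 * K * V / x ≤ P := by
    rw [hPdef]; push_cast; linarith [Nat.le_ceil (16 * K * V / x)]
  set w : ℕ → ℝ := fun n ↦ (c n).toReal with hwdef
  have hw0 : ∀ n, 0 ≤ w n := fun n ↦ ENNReal.toReal_nonneg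
  have hwc : ∀ n, ENNReal.ofReal (w n) = c n := fun n ↦ ENNReal.ofReal_toReal (hcfin n)
  have hW1 : ∑ n ∈ Finset.range P, w n ≤ 1 := sum_toReal_le_one_of_tsum_eq_one hc1 P
  set μ : ℝ := ∑ n ∈ Finset.range P, w n * (n : ℕ) with hμdef
  have hμ_ge : V * (1 - x / 16) ≤ μ := by
    have := truncatedMean_ge hc1 hV0 hK hx0 hP hPge hcN (by rwa [hVdef])
    rw [hμdef]
    exact this
  have hμ0 : 0 < μ := lt_of_lt_of_le (by nlinarith) hμ_ge
  -- the density condition of the mixture theorem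
  have hρd : ρ * (Lp + 2 * ℓ + R' + 1) ^ 3 * ∑ n ∈ Finset.range P, w n <
      ∑ n ∈ Finset.range P, w n * ((fun n : ℕ ↦ n) n : ℕ) := by
    show ρ * (Lp + 2 * ℓ + R' + 1) ^ 3 * ∑ n ∈ Finset.range P, w n < μ
    have h1 : 2 * ℓ ≤ Lp * x := by
      rw [hℓdef]
      calc 2 * (Lp / (2 * M)) = Lp * (M : ℝ)⁻¹ := by field_simp
        _ ≤ Lp * x := by gcongr
    have hLpge : (2 * ρ)⁻¹ ≤ Lp := (inv_le_comm₀ hLp0 (by positivity)).1 hLpinv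
    have h2 : R' + 1 ≤ Lp * x := by
      have h9 : ρ = ρ ^ ((2 : ℝ) / 5) * ρ ^ ((3 : ℝ) / 5) := by
        rw [← Real.rpow_add hρ]; norm_num
      have h4 : (R' + 1) * (2 * ρ) ≤ x := by
        calc (R' + 1) * (2 * ρ) = (2 * (R' + 1) * ρ ^ ((2 : ℝ) / 5)) * ρ ^ ((3 : ℝ) / 5) := by
              conv_lhs => rw [h9]
              ring
          _ ≤ 1 * ρ ^ ((3 : ℝ) / 5) := by gcongr
          _ = x := by rw [one_mul, hxdef]
      have h5 : R' + 1 ≤ x * (2 * ρ)⁻¹ := by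
        rw [← div_eq_mul_inv, le_div_iff₀ (by positivity)]; exact h4
      exact h5.trans (by nlinarith [mul_le_mul_of_nonneg_left hLpge hx0.le])
    have hd : Lp + 2 * ℓ + R' + 1 ≤ Lp * (1 + 2 * x) := by
      have : Lp * (1 + 2 * x) = Lp + Lp * x + Lp * x := by ring
      linarith
    have hd0 : 0 ≤ Lp + 2 * ℓ + R' + 1 := by positivity
    have hW0 : 0 ≤ ∑ n ∈ Finset.range P, w n := Finset.sum_nonneg fun n _ ↦ hw0 n
    calc ρ * (Lp + 2 * ℓ + R' + 1) ^ 3 * ∑ n ∈ Finset.range P, w n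
        ≤ ρ * (Lp * (1 + 2 * x)) ^ 3 * 1 := by gcongr
      _ = ρ * Lp ^ 3 * (1 + 2 * x) ^ 3 := by ring
      _ < ρ * Lp ^ 3 * ((1 + 8 * x) * (1 - x / 16)) :=
          mul_lt_mul_of_pos_left (one_add_two_mul_pow_three_lt' hx0 hx) (by positivity)
      _ = V * (1 - x / 16) := by rw [hVdef, hρtdef]; ring
      _ ≤ μ := hμ_ge
  have hmix := limsup_energyDensity_le_of_mixture_real hv' hmeas hR'0 (L₀ := Lp + 2 * ℓ) (by positivity)
    (fun n : ℕ ↦ n) w hw0 hρ (d := Lp + 2 * ℓ + R' + 1) (by linarith) hρd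
  -- the energy of the truncated mixture
  have hEsum : ∑ n ∈ Finset.range P, ENNReal.ofReal (w n) * groundStateEnergy v ((fun n : ℕ ↦ n) n) (Lp + 2 * ℓ) ≤
      ENNReal.ofReal ((1 + 4 / (M : ℝ)) * (B * Lp ^ 3) + Cl / (M * ℓ ^ 2) * (Real.sqrt K * V)) := by
    simp only [hwc]
    have h1 := truncatedEnergy_le hD0 hlocN hc1 hK hV0 (by rwa [hVdef]) hcE P
    have h14 : (1 + 4 / (M : ℝ≥0∞)) = ENNReal.ofReal (1 + 4 / (M : ℝ)) := by
      rw [ENNReal.ofReal_add zero_le_one (by positivity), ENNReal.ofReal_one,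
        ENNReal.ofReal_div_of_pos hMr, ENNReal.ofReal_ofNat, ENNReal.ofReal_natCast]
    refine h1.trans (le_of_eq ?_)
    rw [h14, ← ENNReal.ofReal_mul (by positivity), ← ENNReal.ofReal_add (by positivity) (by positivity)]
  -- the main real bounds
  set MT : ℝ := 4 * Real.pi * ρ ^ 2 * a * (1 + lhyConstant * Real.sqrt (ρ * a ^ 3)) with hMT
  have hmain : ρ / ρt * B ≤ MT + C₁ * ρ ^ ((5 : ℝ) / 2 + 1 / 10) :=
    lhy_mainTerm_adjusted_le (c₀ := lhyConstant) (K := K) ha0 hc₀.le hK.le hρ hρ1 hx8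
  have hMT0 : 0 ≤ MT := by positivity
  have hMTle : MT ≤ T₀ * ρ ^ 2 := by
    rw [hMT, hT₀]
    have : Real.sqrt (ρ * a ^ 3) ≤ Real.sqrt (a ^ 3) :=
      Real.sqrt_le_sqrt (mul_le_of_le_one_left (pow_nonneg ha0 3) hρ1)
    calc 4 * Real.pi * ρ ^ 2 * a * (1 + lhyConstant * Real.sqrt (ρ * a ^ 3))
        ≤ 4 * Real.pi * ρ ^ 2 * a * (1 + lhyConstant * Real.sqrt (a ^ 3)) := by gcongr
      _ = _ := by ring
  have hρ26 : ρ ^ ((5 : ℝ) / 2 + 1 / 10) = ρ ^ 2 * x := by rw [hxdef, sq_mul_rpow_three_fifths hρ]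
  have hcomb : ρ * x⁻¹ * ρ ^ ((11 : ℝ) / 5) = ρ ^ ((5 : ℝ) / 2 + 1 / 10) := by
    rw [hxdef]; exact mul_rpow_inv_three_fifths_mul hρ
  have hbook := gc_assembly_bookkeeping (K := K) (Cl := Cl) (T₀ := T₀) hρ hx0 hx hCl hMr hMle hMinv hLp0
    hLpinv2 hV0 hVdef hρt0 hμ_ge hB0 hmain hMT0 hMTle hC₁0.le hρ26 hcomb
  rw [← hℓdef] at hbook
  -- assemble
  calc limsup (fun N : ℕ ↦ groundStateEnergy v N (sideLength ρ N) / ENNReal.ofReal (sideLength ρ N ^ 3)) atTop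
      ≤ ENNReal.ofReal (ρ / μ) * ∑ n ∈ Finset.range P, ENNReal.ofReal (w n) *
          groundStateEnergy v ((fun n : ℕ ↦ n) n) (Lp + 2 * ℓ) := hmix
    _ ≤ ENNReal.ofReal (ρ / μ) *
          ENNReal.ofReal ((1 + 4 / (M : ℝ)) * (B * Lp ^ 3) + Cl / (M * ℓ ^ 2) * (Real.sqrt K * V)) := by
        gcongr
    _ = ENNReal.ofReal (ρ / μ * ((1 + 4 / (M : ℝ)) * (B * Lp ^ 3)) +
          ρ / μ * (Cl / (M * ℓ ^ 2) * (Real.sqrt K * V))) := by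
        rw [← ENNReal.ofReal_mul (by positivity), mul_add]
    _ ≤ ENNReal.ofReal (MT + C * ρ ^ ((5 : ℝ) / 2 + 1 / 10)) := by
        refine ENNReal.ofReal_le_ofReal ?_
        rw [hC]
        exact hbook

end Literature.MathematicalPhysics.QuantumManyBody.BoseGas

end
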